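import Summits.QuantumFields.YangMills.Theorems.NPointIsotropy.Negative.TieLoadBearing
import Summits.QuantumFields.YangMills.Theorems.NPointIsotropy.Negative.NPointRegularJunk
import Summits.QuantumFields.YangMills.Theorems.CurvatureBoostCovariance.Negative.Unbundled
import Summits.QuantumFields.YangMills.Theorems.PencilRigidityNPointIsotropyFrameTransport
import Summits.QuantumFields.YangMills.Theorems.PencilRigidityNPointIsotropyCorner
import Summits.QuantumFields.YangMills.Theorems.PencilRigidityNPointIsotropyEighthTurnPropagation
import Summits.QuantumFields.YangMills.Theorems.PencilRigidityNPointIsotropyUnorderedRP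
import Summits.QuantumFields.YangMills.Theorems.PencilRigidityNPointIsotropyOneAngleAmplification
import HarnessLib.Audit

/-!
# Line `quarter-turn-corner-operator` — LEAD skeleton (lead-1 generation 1) for crux `PencilRigidity.NPointIsotropy`
(stmt-QuantumFields-11686; lead prover `prover-line-stmt-QuantumFields-11686-1`, seated 2026-08-16T10:12Z on the
"remaining lines" after the opening lead's `promote-stub: stub_tieRegularity`; the continuation seat
`prover-line-stmt-QuantumFields-11686-c1-0` drives `complex-rotation-bandlimit` gen 5 in parallel — this file touches
none of its stubs and SHARES the two stubs common to every line, `stub_tieRegularity` and `stub_planarCone`, by stating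
them byte-for-byte as registered by the gen-4 skeleton, so one proof serves both lines).

Idea (card `Cruxes/NPointIsotropy/Ideas/quarter-turn-corner-operator.md`, planner skeleton
`Cruxes/NPointIsotropy/Lines/quarter-turn-corner-operator.lean`): the diagonal mirror `x⁰ = x¹` is the axis mirror
`x⁰ = 0` followed by the hypercubic quarter-turn `Rq : e₀ ↦ e₁, e₁ ↦ -e₀` (a symmetry the crux HAS), so diagonal
reflection positivity read in the `e₀`-quantisation makes `P : [G] ↦ [Rq·G]` a POSITIVE SYMMETRIC operator on quadrant
vectors (`G` supported in `Q = {x⁰ > 0 > x¹}`) of the `e₀`-Osterwalder–Schrader space — the continuum corner transfer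
operator. The bet (stub D) is that the positive square root of its Friedrichs extension is the eighth-turn,
`A^{1/2}[G] = [R_{π/4}·G]` (polarised, at distribution level, on quadrant-supported off-diagonal tests); stub E
propagates the identity to `R_{π/4}`-invariance on `⁰𝒮` (the rotation by `π/4` permutes the eight planar frames, so the
planar cone of the ROTATED family is available); stub F amplifies one angle to all (`⟨W(B₄)⁺, R_{π/4}⟩` is dense in
`SO(4)`; invariance groups of tempered families on `⁰𝒮` are closed).

CHANGES w.r.t. the planner's skeleton (lead-1 gen 1):
* every stub is spelled over IMPORTABLE vocabulary only (`SchwingerFamily`, `E4`, `IsOffDiagonal`, `IsPositiveTimeMulti`,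
  `IsAppendTensorOf`, `osAdjoint`, `linActMulti`, the landed `Negative.NPointRegular` / `Negative.RadialKernel` and the landed
  unbundling `OSPackage Translations Hypercubic EightFrameRP PlanarInvariant W1`), the line-local predicates of the planner's
  file (`UnorderedRP`, `EightFrameUnorderedRP`, `IsQuarterTurn`, `IsEighthTurn`, `IsQuadrantSupported`, `EighthTurnIdentity`,
  `EighthTurnInvariant`) UNFOLDED in place, because a stub worker's `Theorems/` file must state the registered signature
  byte-for-byte and cannot import `Cruxes/…/Lines/*.lean`;
* stub A = the registered gen-4 `stub_tieRegularity` VERBATIM (function residual = `NPointRegular` unfolded; arbitrary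
  Borel structure on `G`); stub C = the registered gen-4 `stub_planarCone` VERBATIM (= stmt-QuantumFields-9664);
* the planner's stub B is SPLIT into B1 `stub_unorderedRP` (one frame, abstract: ordered E2 + E3 + function residual ⇒
  unordered E2 on `⁰𝒮`) and B2 `stub_frameTransport` (E3 and the residual pass to every pulled-back family
  `S ∘ linActMulti R`), so that B1 is a clean reusable OS-theory lemma; B1 + B2 give the planner's `EightFrameUnorderedRP`
  inside the composition (`eightFrameUnorderedRP_of`).
Composition `NPointIsotropy_of` is sorry-free and concludes the crux BY NAME; sorries live only in `stub_*`.

STATUS after wave 1 (lead-1 cycle 1, 2026-08-16T13:0xZ): B1 `stub_unorderedRP` (p103179; helpers p99724, p100899),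
B2 `stub_frameTransport` (p97790), E `stub_eighthTurnPropagation` (p99270), F `stub_oneAngleAmplification` (p103012;
helpers p99981, p101235, p101238) are CLOSED by import of the landed theorems; D's sub-goals `Corner.corner_form_nonneg`
(p98907: the corner operator `P:[G]↦[Rq·G]` is positive) and `DegreeLeTwo.eighthTurnIdentity_degree_le_two` (p100946:
the bet in slots m+n ≤ 2) are landed. The THREE remaining sorries are exactly: A (Step 0, promoted, shared), C (= stmt-9664,
shared), D (the bet = the regular model-blind core in corner dress: by worker E's proof its vacuum slots already state
`R₈`-invariance on quadrant tests). So this line certifies: NPointIsotropy ⟸ Step 0 ∧ PlanarSpectralCone ∧ D.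

GLOSSARY (planner's names ↔ unfolded text):
* `NPointRegular S` (landed def) = `∀ n, ∃ W, ∀ F, IsOffDiagonal F → Integrable (W·F) ∧ S n F = ∫ W·F`.
* `UnorderedRP S` ↔ `∀ N F, (∀ n, N < n → F n = 0) → (∀ n, IsPositiveTimeMulti (F n)) → (∀ n, IsOffDiagonal (F n)) →
  ∀ H, (∀ n m, IsAppendTensorOf (H n m) (osAdjoint (F n)) (F m)) → 0 ≤ (Σ Σ S (n+m) (H n m)).re ∧ (Σ Σ …).im = 0`.
* `EightFrameUnorderedRP S` ↔ `∀ R a b, a²+b²=1 → (a=0 ∨ b=0 ∨ a²=b²) → R e₀ = a e₀ + b e₁ → UnorderedRP (S ∘ linActMulti R)`.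
* `IsQuarterTurn Rq` ↔ `Rq e₀ = e₁ ∧ Rq e₁ = -e₀ ∧ Rq e₂ = e₂ ∧ Rq e₃ = e₃`;
  `IsEighthTurn R₈` ↔ `R₈ e₀ = (√2/2)e₀ + (√2/2)e₁ ∧ R₈ e₁ = -((√2/2)e₀) + (√2/2)e₁ ∧ R₈ e₂ = e₂ ∧ R₈ e₃ = e₃`;
  `IsQuadrantSupported G` ↔ `tsupport G ⊆ {x | ∀ i, 0 < x i 0 ∧ x i 1 < 0}`.
-/

noncomputable section

-- Mathlib's `SimplexCategory` instance `Fintype (Fin (x.len + 1))` matches `Fintype (Fin 4)` (tree-known workaround).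
attribute [-instance] SimplexCategory.instFintypeToTypeOrderHomFinHAddNatLenOfNat

namespace Summit.QuantumFields.YangMills.Cruxes.NPointIsotropy.QuarterTurnCornerOperator

open scoped BigOperators SchwartzMap
open MeasureTheory Filter Topology
open Literature.MathematicalPhysics.QuantumLattice Literature.MathematicalPhysics.AQFT
  Literature.MathematicalPhysics.QuantumFieldTheory
open Summit.QuantumFields.YangMills.Theorems.NPointIsotropy.Negative (E4 RadialKernel NPointRegular nPointIsotropy_iff)
open Summit.QuantumFields.YangMills.Theorems.CurvatureBoostCovariance.Negative
  (OSPackage Translations Hypercubic EightFrameRP PlanarInvariant Tie Gaps W1 isOffDiagonal_linActMulti)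

/-! ## §1 The stubs (statements over importable vocabulary only; each wrapped in its own `open … in`) -/

/-- **Stub A — Step 0, the stub that USES THE TIE (SHARED with line `complex-rotation-bandlimit`, registered by its
gen-4 skeleton; stated here byte-for-byte).** For every compact simple `G` (any Borel structure), `r`, `sch` and
one-species family `S₁` with `W1 r sch S₁` (tie at every order, OS package, translations, proper hypercubic invariance,
both gaps), the eight planar frames and the radial kernel: every `𝔖ₙ|⁰𝒮` is a FUNCTION. Opening lead's verdict
(promoted to the planner): crux-sized for `n ≥ 3` (n-point UV regularity of the tied Wilson limit); the c1 seat
discharges `n = 1` through the tie. Not worked in this line. -/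
theorem stub_tieRegularity :
    open Literature.MathematicalPhysics.QuantumLattice Literature.MathematicalPhysics.AQFT
      Literature.MathematicalPhysics.QuantumFieldTheory
      Summit.QuantumFields.YangMills.Theorems.CurvatureBoostCovariance.Negative
      Summit.QuantumFields.YangMills.Theorems.NPointIsotropy.Negative in
    ∀ (G : Type) [Group G] [TopologicalSpace G] [IsTopologicalGroup G] [CompactSpace G]
      [MeasurableSpace G] [BorelSpace G], IsCompactSimpleLieGroup G →
      ∀ (r : LatticeRep G) (sch : SpeciesScheme (YMSpecies G)) (S₁ : SchwingerFamily E4),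
        W1 r sch S₁ → EightFrameRP S₁ → RadialKernel S₁ →
        ∀ n : ℕ, ∃ W : (Fin n → E4) → ℂ, ∀ F : SchwartzMap (Fin n → E4) ℂ, IsOffDiagonal F →
          MeasureTheory.Integrable (fun x : Fin n → E4 => W x * F x) ∧
            S₁ n F = ∫ x : Fin n → E4, W x * F x := by
  sorry

/-- **Stub B1 — unordered reflection positivity on `⁰𝒮` from the function residual (one frame, abstract; CLOSED,
wave 1).** For a one-species family with ORDERED E2 (`IsReflectionPositive`: time-ordered entries), E3
(`IsSymmetric` on `⁰𝒮`) and every `𝔖ₙ|⁰𝒮` a function (`NPointRegular`), E2 holds in the UNORDERED `𝒮₊` form on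
off-diagonal entries: for positive-time-supported, off-diagonal `F₀,…,F_N`, `Σₙₘ 𝔖ₙ₊ₘ(ΘFₙ* ⊗ Fₘ) ≥ 0`.
Proof route: cut each `Fₙ` off near the equal-time walls `{xᵢ⁰ = xⱼ⁰}` by `Σ_π Π_{k} ψ₊((x⁰_{π(k+1)} - x⁰_{π(k)})/ε)`
(smooth, temperate growth; at most one ordering `π` survives at each point); each piece is a permutation
(`permTest`) of a time-ORDERED function, so ordered E2 for the finite family of pieces + E3 give positivity of the
cut-off Gram sum; the walls are Lebesgue-null and `W_{n+m}·(ΘFₙ*⊗Fₘ)` is integrable, so dominated convergence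
(`ε → 0`) passes positivity to the limit. False without the residual (junk family `𝔖₄ = J`). -/
theorem stub_unorderedRP :
    open Literature.MathematicalPhysics.QuantumLattice Literature.MathematicalPhysics.AQFT
      Summit.QuantumFields.YangMills.Theorems.NPointIsotropy.Negative in
    ∀ (S₁ : SchwingerFamily E4), S₁.toLabelled.IsReflectionPositive → S₁.toLabelled.IsSymmetric →
      NPointRegular S₁ →
      ∀ (N : ℕ) (F : (n : ℕ) → SchwartzMap (Fin n → E4) ℂ),
        (∀ n, N < n → F n = 0) → (∀ n, IsPositiveTimeMulti (F n)) → (∀ n, IsOffDiagonal (F n)) →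
        ∀ H : (n m : ℕ) → SchwartzMap (Fin (n + m) → E4) ℂ,
          (∀ n m, IsAppendTensorOf (H n m) (osAdjoint (F n)) (F m)) →
          0 ≤ (∑ n ∈ Finset.range (N + 1), ∑ m ∈ Finset.range (N + 1), S₁ (n + m) (H n m)).re ∧
            (∑ n ∈ Finset.range (N + 1), ∑ m ∈ Finset.range (N + 1), S₁ (n + m) (H n m)).im = 0 :=
  -- CLOSED (wave 1): `Theorems/PencilRigidityNPointIsotropyUnorderedRP.lean` (+ helpers …UnorderedRPTransport/Cutoff)
  Summit.QuantumFields.YangMills.Theorems.NPointIsotropy.QuarterTurnCornerOperator.stub_unorderedRP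

/-- **Stub B2 — frame transport of E3 and of the function residual (CLOSED: p97790, wave 1).** For every linear
isometry `R`, the pulled-back family `S ∘ linActMulti R` inherits E3 on `⁰𝒮` (`permTest` commutes with
`linActMulti`; `⁰𝒮` is `linActMulti`-stable) and the function residual (`W ↦ W ∘ (R · )` coordinatewise; Lebesgue
measure on `(ℝ⁴)ⁿ` is `R`-invariant). With B1 this gives unordered E2 in each of the eight planar frames. -/
theorem stub_frameTransport :
    open Literature.MathematicalPhysics.QuantumLattice Literature.MathematicalPhysics.AQFT
      Summit.QuantumFields.YangMills.Theorems.NPointIsotropy.Negative in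
    ∀ (S₁ : SchwingerFamily E4) (R : E4 ≃ₗᵢ[ℝ] E4), S₁.toLabelled.IsSymmetric → NPointRegular S₁ →
      (SchwingerFamily.toLabelled (fun n => (S₁ n).comp (linActMulti R))).IsSymmetric ∧
        NPointRegular (fun n => (S₁ n).comp (linActMulti R)) :=
  -- CLOSED (wave 1): `Theorems/PencilRigidityNPointIsotropyFrameTransport.lean`, p97790 ACCEPTED
  Summit.QuantumFields.YangMills.Theorems.NPointIsotropy.QuarterTurnCornerOperator.stub_frameTransport

/-- **Stub C — the planar spectral cone (SHARED: = stmt-QuantumFields-9664 `MirrorModularBoosts.PlanarSpectralCone`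
verbatim, registered by the gen-4 skeleton of line `complex-rotation-bandlimit`; staffed on its own seat).** -/
theorem stub_planarCone :
    open Literature.MathematicalPhysics.QuantumLattice Literature.MathematicalPhysics.AQFT
      Summit.QuantumFields.YangMills.Theorems.CurvatureBoostCovariance.Negative
      Summit.QuantumFields.YangMills.Theorems.NPointIsotropy.Negative in
    ∀ S₁ : SchwingerFamily E4, S₁.toLabelled.HasLinearGrowth → S₁.toLabelled.IsSymmetric →
      Translations S₁ → EightFrameRP S₁ → PlanarCone S₁ := by
  sorry

/-- **Stub D — THE BET (size XL; held by the lead): the positive square root of the corner operator is the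
eighth-turn.** STATUS after wave 1 (worker E, p99270; lead's `work/D_analysis.md`, item evidence): the vacuum slots
`(m, 0)` of this identity already say `𝔖ₘ(R₈⁻¹·A) = 𝔖ₘ(A)` for quadrant-supported `A` (so E needed only translations +
the function residual), i.e. D is EQUIVALENT, over the other hypotheses, to `R₈`-invariance on quadrant / sector-split
tests — the regular model-blind core in corner dress (first open degree 3 = Disproof §12 form-factor invariance on
quadrant displacements); corner positivity `P ≥ 0` is certified (`Corner.corner_form_nonneg`, p98907); the
perturbative test to second order with unitarity favours it; the named missing model-blind identity is an OS-space
optical theorem. Hypotheses: OS package, translations, proper hypercubic invariance, gap, E2 in the eight planar frames,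
the radial two-point kernel, the function residual, UNORDERED E2 in the eight frames (B1+B2) and the planar spectral
cone (C). Conclusion (`EighthTurnIdentity`, unfolded): for the quarter-turn `Rq` (`e₀ ↦ e₁ ↦ -e₀`) and the eighth-turn
`R₈` (`R₈² = Rq`), and quadrant-supported (`Q = {x⁰ > 0 > x¹}`) off-diagonal `G₁` (`m` points), `G₂` (`n` points),
`𝔖ₘ₊ₙ(Θ(R₈·G₁)* ⊗ R₈·G₂) = 𝔖ₘ₊ₙ(ΘG₁* ⊗ Rq·G₂)`, i.e. `⟨A^{1/2}[G₁], A^{1/2}[G₂]⟩ = ⟨[G₁], A[G₂]⟩` for the corner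
operator `A[G] = [Rq·G]` (positive symmetric on quadrant vectors of the `e₀`-OS space by diagonal unordered E2 —
`Θ∘Rq` is the diagonal mirror). Implied by the crux (`Θ(R₈G₁)*⊗R₈G₂ = R₈⁻¹·(ΘG₁*⊗RqG₂)`); open both ways below the
typed hypotheses (GaierYngvason2000; Disproof §11: no counterexample in the Borchers class of RP generalised free
fields). Cheapest falsifier: two-particle quadrant wave packets of the massive free field (must hold). -/
theorem stub_eighthTurnIdentity :
    open Literature.MathematicalPhysics.QuantumLattice Literature.MathematicalPhysics.AQFT
      Literature.MathematicalPhysics.QuantumFieldTheory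
      Summit.QuantumFields.YangMills.Theorems.CurvatureBoostCovariance.Negative
      Summit.QuantumFields.YangMills.Theorems.NPointIsotropy.Negative in
    ∀ (S₁ : SchwingerFamily E4), OSPackage S₁ → Translations S₁ → Hypercubic S₁ →
      (∃ Δ : ℝ, 0 < Δ ∧ S₁.toLabelled.HasMassGap Δ) → EightFrameRP S₁ → RadialKernel S₁ → NPointRegular S₁ →
      (∀ (R : E4 ≃ₗᵢ[ℝ] E4) (a b : ℝ), a ^ 2 + b ^ 2 = 1 → (a = 0 ∨ b = 0 ∨ a ^ 2 = b ^ 2) →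
        R (EuclideanSpace.single 0 1) = a • EuclideanSpace.single 0 1 + b • EuclideanSpace.single 1 1 →
        ∀ (N : ℕ) (F : (n : ℕ) → SchwartzMap (Fin n → E4) ℂ),
          (∀ n, N < n → F n = 0) → (∀ n, IsPositiveTimeMulti (F n)) → (∀ n, IsOffDiagonal (F n)) →
          ∀ H : (n m : ℕ) → SchwartzMap (Fin (n + m) → E4) ℂ,
            (∀ n m, IsAppendTensorOf (H n m) (osAdjoint (F n)) (F m)) →
            0 ≤ (∑ n ∈ Finset.range (N + 1), ∑ m ∈ Finset.range (N + 1),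
                (S₁ (n + m)).comp (linActMulti R) (H n m)).re ∧
              (∑ n ∈ Finset.range (N + 1), ∑ m ∈ Finset.range (N + 1),
                (S₁ (n + m)).comp (linActMulti R) (H n m)).im = 0) →
      Summit.QuantumFields.YangMills.Theses.MirrorModularBoosts.PlanarSpectralCone →
      ∀ (Rq R₈ : E4 ≃ₗᵢ[ℝ] E4),
        (Rq (EuclideanSpace.single 0 1) = EuclideanSpace.single 1 1 ∧
          Rq (EuclideanSpace.single 1 1) = -EuclideanSpace.single 0 1 ∧
          Rq (EuclideanSpace.single 2 1) = EuclideanSpace.single 2 1 ∧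
          Rq (EuclideanSpace.single 3 1) = EuclideanSpace.single 3 1) →
        (R₈ (EuclideanSpace.single 0 1) =
            (Real.sqrt 2 / 2) • EuclideanSpace.single 0 1 + (Real.sqrt 2 / 2) • EuclideanSpace.single 1 1 ∧
          R₈ (EuclideanSpace.single 1 1) =
            -((Real.sqrt 2 / 2) • EuclideanSpace.single 0 1) + (Real.sqrt 2 / 2) • EuclideanSpace.single 1 1 ∧
          R₈ (EuclideanSpace.single 2 1) = EuclideanSpace.single 2 1 ∧
          R₈ (EuclideanSpace.single 3 1) = EuclideanSpace.single 3 1) →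
        ∀ (m n : ℕ) (G₁ : SchwartzMap (Fin m → E4) ℂ) (G₂ : SchwartzMap (Fin n → E4) ℂ),
          tsupport (G₁ : (Fin m → E4) → ℂ) ⊆ {x | ∀ i, 0 < x i 0 ∧ x i 1 < 0} →
          tsupport (G₂ : (Fin n → E4) → ℂ) ⊆ {x | ∀ i, 0 < x i 0 ∧ x i 1 < 0} →
          IsOffDiagonal G₁ → IsOffDiagonal G₂ →
          ∀ (H H' : SchwartzMap (Fin (m + n) → E4) ℂ),
            IsAppendTensorOf H (osAdjoint (linActMulti R₈ G₁)) (linActMulti R₈ G₂) →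
            IsAppendTensorOf H' (osAdjoint G₁) (linActMulti Rq G₂) →
            S₁ (m + n) H = S₁ (m + n) H' := by
  sorry

/-- **Stub E — propagation: eighth-turn identity ⇒ `R_{π/4}`-invariance on `⁰𝒮` (CLOSED: p99270, wave 1).**
Since `Θ(R₈G₁)*⊗R₈G₂ = R₈⁻¹·(ΘG₁*⊗RqG₂)`, the identity says `𝔖(R₈⁻¹·H') = 𝔖(H')` on corner-split tests `H'` (one group
in `{x⁰<0, x¹<0}`, the other in `{x⁰>0, x¹>0}`; translations move the corner, E3 reorders). For a.e. configuration
(unique lowest-`e₀`-time point `p`, rest `h`) put `T_b := Θg̃* ⊗ τ_{b(e₀+e₁)/√2} h`: `b ↦ 𝔖(T_b)` and `b ↦ 𝔖(R₈⁻¹·T_b)` are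
both real-analytic on `(-ε, ∞)` — planar-cone functions (C) of `S` and of the pulled-back family `S ∘ linActMulti R₈`,
which has the SAME eight frames (rotation by `π/4` permutes axis and diagonal directions), the same E0', E3 (B2) and
translations, with unordered groups handled by B1 — and agree for `b ≫ 0` (corner-split), hence at `b = 0`; tensor
density then gives `Wₙ∘R₈ = Wₙ` a.e., i.e. invariance on `⁰𝒮` (no model-blind mop-up over the junk locus is claimed:
everything is an a.e. statement about the representing functions). -/
theorem stub_eighthTurnPropagation :
    open Literature.MathematicalPhysics.QuantumLattice Literature.MathematicalPhysics.AQFT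
      Literature.MathematicalPhysics.QuantumFieldTheory
      Summit.QuantumFields.YangMills.Theorems.CurvatureBoostCovariance.Negative
      Summit.QuantumFields.YangMills.Theorems.NPointIsotropy.Negative in
    ∀ (S₁ : SchwingerFamily E4), OSPackage S₁ → Translations S₁ → Hypercubic S₁ → EightFrameRP S₁ →
      NPointRegular S₁ →
      (∀ (R : E4 ≃ₗᵢ[ℝ] E4) (a b : ℝ), a ^ 2 + b ^ 2 = 1 → (a = 0 ∨ b = 0 ∨ a ^ 2 = b ^ 2) →
        R (EuclideanSpace.single 0 1) = a • EuclideanSpace.single 0 1 + b • EuclideanSpace.single 1 1 →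
        ∀ (N : ℕ) (F : (n : ℕ) → SchwartzMap (Fin n → E4) ℂ),
          (∀ n, N < n → F n = 0) → (∀ n, IsPositiveTimeMulti (F n)) → (∀ n, IsOffDiagonal (F n)) →
          ∀ H : (n m : ℕ) → SchwartzMap (Fin (n + m) → E4) ℂ,
            (∀ n m, IsAppendTensorOf (H n m) (osAdjoint (F n)) (F m)) →
            0 ≤ (∑ n ∈ Finset.range (N + 1), ∑ m ∈ Finset.range (N + 1),
                (S₁ (n + m)).comp (linActMulti R) (H n m)).re ∧
              (∑ n ∈ Finset.range (N + 1), ∑ m ∈ Finset.range (N + 1),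
                (S₁ (n + m)).comp (linActMulti R) (H n m)).im = 0) →
      Summit.QuantumFields.YangMills.Theses.MirrorModularBoosts.PlanarSpectralCone →
      (∀ (Rq R₈ : E4 ≃ₗᵢ[ℝ] E4),
        (Rq (EuclideanSpace.single 0 1) = EuclideanSpace.single 1 1 ∧
          Rq (EuclideanSpace.single 1 1) = -EuclideanSpace.single 0 1 ∧
          Rq (EuclideanSpace.single 2 1) = EuclideanSpace.single 2 1 ∧
          Rq (EuclideanSpace.single 3 1) = EuclideanSpace.single 3 1) →
        (R₈ (EuclideanSpace.single 0 1) =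
            (Real.sqrt 2 / 2) • EuclideanSpace.single 0 1 + (Real.sqrt 2 / 2) • EuclideanSpace.single 1 1 ∧
          R₈ (EuclideanSpace.single 1 1) =
            -((Real.sqrt 2 / 2) • EuclideanSpace.single 0 1) + (Real.sqrt 2 / 2) • EuclideanSpace.single 1 1 ∧
          R₈ (EuclideanSpace.single 2 1) = EuclideanSpace.single 2 1 ∧
          R₈ (EuclideanSpace.single 3 1) = EuclideanSpace.single 3 1) →
        ∀ (m n : ℕ) (G₁ : SchwartzMap (Fin m → E4) ℂ) (G₂ : SchwartzMap (Fin n → E4) ℂ),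
          tsupport (G₁ : (Fin m → E4) → ℂ) ⊆ {x | ∀ i, 0 < x i 0 ∧ x i 1 < 0} →
          tsupport (G₂ : (Fin n → E4) → ℂ) ⊆ {x | ∀ i, 0 < x i 0 ∧ x i 1 < 0} →
          IsOffDiagonal G₁ → IsOffDiagonal G₂ →
          ∀ (H H' : SchwartzMap (Fin (m + n) → E4) ℂ),
            IsAppendTensorOf H (osAdjoint (linActMulti R₈ G₁)) (linActMulti R₈ G₂) →
            IsAppendTensorOf H' (osAdjoint G₁) (linActMulti Rq G₂) →
            S₁ (m + n) H = S₁ (m + n) H') →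
      ∀ R₈ : E4 ≃ₗᵢ[ℝ] E4,
        (R₈ (EuclideanSpace.single 0 1) =
            (Real.sqrt 2 / 2) • EuclideanSpace.single 0 1 + (Real.sqrt 2 / 2) • EuclideanSpace.single 1 1 ∧
          R₈ (EuclideanSpace.single 1 1) =
            -((Real.sqrt 2 / 2) • EuclideanSpace.single 0 1) + (Real.sqrt 2 / 2) • EuclideanSpace.single 1 1 ∧
          R₈ (EuclideanSpace.single 2 1) = EuclideanSpace.single 2 1 ∧
          R₈ (EuclideanSpace.single 3 1) = EuclideanSpace.single 3 1) →
        ∀ (n : ℕ) (F : SchwartzMap (Fin n → E4) ℂ), IsOffDiagonal F → S₁ n (linActMulti R₈ F) = S₁ n F :=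
  -- CLOSED (wave 1): `Theorems/PencilRigidityNPointIsotropyEighthTurnPropagation.lean`, p99270 (review: accept).
  -- NOTE (worker E): the proof uses only the vacuum slots (m,0) of the identity hypothesis D, translations and the
  -- function residual; the cone, E2, E3 are unused — D's one-sided slots already state R₈-invariance on quadrant tests.
  Summit.QuantumFields.YangMills.Theorems.NPointIsotropy.QuarterTurnCornerOperator.stub_eighthTurnPropagation

/-- **Stub F — one-angle amplification (pure group theory + topology; CLOSED, wave 1).** Invariance on `⁰𝒮`
under the proper signed permutations `W(B₄) ∩ SO(4)` and under ONE rotation by `π/4` of the `(x₀,x₁)`-plane forces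
invariance under every determinant-one isometry fixing `e₂, e₃`. Route: (i) for fixed off-diagonal `F`,
`θ ↦ 𝔖ₙ(planeRot 0 θ · F)` is continuous (Schwartz seminorm estimate for linear maps near the identity, the
`linActMulti` analogue of the tree's `seminorm_compSubConstCLM_sub_le`), so the set of invariance angles is a CLOSED
subgroup of `ℝ`; (ii) it is not cyclic: `Γ = ⟨W(B₄)⁺, R₈⟩` contains simple rotations of irrational angle (e.g.
`R₈ · (R₈ conjugated into the (x₀,x₂)-plane)`, `cos(γ/2) = cos²(π/8)` is not half an algebraic integer), whose powers
accumulate, and three-factor products of such plane rotations realise small `(x₀,x₁)`-rotations; a closed non-cyclic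
subgroup of `ℝ` is everything (`AddSubgroup.dense_or_cyclic`); (iii) every det-1 isometry fixing `e₂,e₃` is a
`planeRot 0 θ` (landed `exists_eq_planeRot`). Junk-proof (junk is not `R₈`-invariant). -/
theorem stub_oneAngleAmplification :
    open Literature.MathematicalPhysics.QuantumLattice Literature.MathematicalPhysics.AQFT
      Summit.QuantumFields.YangMills.Theorems.CurvatureBoostCovariance.Negative
      Summit.QuantumFields.YangMills.Theorems.NPointIsotropy.Negative in
    ∀ (S₁ : SchwingerFamily E4), Hypercubic S₁ →
      (∀ R₈ : E4 ≃ₗᵢ[ℝ] E4,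
        (R₈ (EuclideanSpace.single 0 1) =
            (Real.sqrt 2 / 2) • EuclideanSpace.single 0 1 + (Real.sqrt 2 / 2) • EuclideanSpace.single 1 1 ∧
          R₈ (EuclideanSpace.single 1 1) =
            -((Real.sqrt 2 / 2) • EuclideanSpace.single 0 1) + (Real.sqrt 2 / 2) • EuclideanSpace.single 1 1 ∧
          R₈ (EuclideanSpace.single 2 1) = EuclideanSpace.single 2 1 ∧
          R₈ (EuclideanSpace.single 3 1) = EuclideanSpace.single 3 1) →
        ∀ (n : ℕ) (F : SchwartzMap (Fin n → E4) ℂ), IsOffDiagonal F → S₁ n (linActMulti R₈ F) = S₁ n F) →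
      PlanarInvariant S₁ :=
  -- CLOSED (wave 1): `Theorems/PencilRigidityNPointIsotropyOneAngleAmplification.lean` (+ …OneAngleSkew/Circle/Axis)
  Summit.QuantumFields.YangMills.Theorems.NPointIsotropy.QuarterTurnCornerOperator.stub_oneAngleAmplification

/-! ## §2 Glue (sorry-free): B1 + B2 ⇒ unordered E2 in the eight planar frames -/

/-- Unordered eight-frame E2 from stubs B1 and B2: apply B1 to each pulled-back family `S₁ ∘ linActMulti R`, whose
ordered E2 is the `EightFrameRP` clause itself and whose E3 / function residual come from B2. -/
theorem eightFrameUnorderedRP_of (S₁ : SchwingerFamily E4) (hOS : OSPackage S₁) (h8 : EightFrameRP S₁)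
    (hreg : NPointRegular S₁) :
    ∀ (R : E4 ≃ₗᵢ[ℝ] E4) (a b : ℝ), a ^ 2 + b ^ 2 = 1 → (a = 0 ∨ b = 0 ∨ a ^ 2 = b ^ 2) →
      R (EuclideanSpace.single 0 1) = a • EuclideanSpace.single 0 1 + b • EuclideanSpace.single 1 1 →
      ∀ (N : ℕ) (F : (n : ℕ) → SchwartzMap (Fin n → E4) ℂ),
        (∀ n, N < n → F n = 0) → (∀ n, IsPositiveTimeMulti (F n)) → (∀ n, IsOffDiagonal (F n)) →
        ∀ H : (n m : ℕ) → SchwartzMap (Fin (n + m) → E4) ℂ,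
          (∀ n m, IsAppendTensorOf (H n m) (osAdjoint (F n)) (F m)) →
          0 ≤ (∑ n ∈ Finset.range (N + 1), ∑ m ∈ Finset.range (N + 1),
              (S₁ (n + m)).comp (linActMulti R) (H n m)).re ∧
            (∑ n ∈ Finset.range (N + 1), ∑ m ∈ Finset.range (N + 1),
              (S₁ (n + m)).comp (linActMulti R) (H n m)).im = 0 := by
  intro R a b hab hcase hR N F hFN hFpos hFoff H hH
  obtain ⟨hsymmR, hregR⟩ := stub_frameTransport S₁ R hOS.2.2.2.2.1 hreg
  exact stub_unorderedRP (fun n => (S₁ n).comp (linActMulti R)) (h8 R a b hab hcase hR) hsymmR hregR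
    N F hFN hFpos hFoff H hH

/-! ## §3 The composition (kernel-checked, sorry-free): the stubs prove the crux BY NAME -/

/-- **`NPointIsotropy` from the stubs.** Tie ⇒ function residual (A); residual ⇒ unordered eight-frame E2 (B1+B2);
cone (C); corner operator ⇒ eighth-turn identity (D); propagation to `R₈`-invariance on `⁰𝒮` (E); one-angle
amplification ⇒ every planar rotation (F). -/
theorem NPointIsotropy_of : Summit.QuantumFields.YangMills.Theses.PencilRigidity.NPointIsotropy := by
  rw [nPointIsotropy_iff]
  intro G _ _ _ _ hG
  letI : MeasurableSpace G := borel G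
  haveI : BorelSpace G := ⟨rfl⟩
  intro r sch S₁ hW h8 hK
  -- Step 0 (the tie): every 𝔖ₙ|⁰𝒮 of the tied family is a function
  have hreg : NPointRegular S₁ := stub_tieRegularity G hG r sch S₁ hW h8 hK
  obtain ⟨-, hOS, htr, hhyp, hgaps⟩ := hW
  have hgap : ∃ Δ : ℝ, 0 < Δ ∧ S₁.toLabelled.HasMassGap Δ := by
    obtain ⟨Δ, hΔ, hgap, -⟩ := hgaps
    exact ⟨Δ, hΔ, hgap⟩
  -- B1 + B2: unordered E2 in the eight planar frames
  have hurp := eightFrameUnorderedRP_of S₁ hOS h8 hreg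
  -- C: the planar spectral cone (= stmt-9664)
  have hcone : Summit.QuantumFields.YangMills.Theses.MirrorModularBoosts.PlanarSpectralCone := stub_planarCone
  -- D: the eighth-turn identity; E: propagation; F: amplification
  have h8th := stub_eighthTurnIdentity S₁ hOS htr hhyp hgap h8 hK hreg hurp hcone
  have hinv := stub_eighthTurnPropagation S₁ hOS htr hhyp h8 hreg hurp hcone h8th
  exact stub_oneAngleAmplification S₁ hhyp hinv

end Summit.QuantumFields.YangMills.Cruxes.NPointIsotropy.QuarterTurnCornerOperator

end
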